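import Summits.QuantumFields.BalabanUV.Beta.GAN24.CoarseGaugeSourceResponse
import Summits.QuantumFields.BalabanUV.Beta.GAN24.VHWordsZeroBorder
import Summits.QuantumFields.BalabanUV.Beta.KernelWardResponse

/-!
# `BalabanUV.Beta.GAN24.FaceDatumMultiplierResponse` — binder row G-an2-4 ∕ (CONV-C), W-slot CT-W, conservation law (C)∕(C)sym AT LEVELS `j ≥ 1`, the multiplier-response letter of
# T2b (this lineage's note `HOME/b2b-balaban-gan24-formalise-leaf-04/g68/EXIT-FACE-CURRENT-TOWER.md` §2 (I2), journal INTENT 8∕10): **THE MULTIPLIER RESPONSE OF THE DRESSED STEP KERNEL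
# TO THE EXIT-FACE DATUM VANISHES** — `Σ'_w 𝟙f(w_β)·X̃♮_j q (Lc•w) (inr m) (inr β) = 0` for every first leg `q`, every `j`, all units: the face weight is `Lc⁻¹·(1 − d(sawtooth))`, the constant
# datum has zero multiplier response ((S2c), 26 `VHWordsZeroBorder.hasSum_dressedStep_mm_col`) and so has the coarse pure-gauge datum ((Z1′), p2's
# `CoarseGaugeSourceResponse.sum_tsum_coarseGrad_colM`)

NOT IN PRINT; OUR BOOKKEEPING ([folklore] BY NAME over 26 `VHWordsZeroBorder.hasSum_dressedStep_mm_col`, p2's `CoarseGaugeSourceResponse.sum_tsum_coarseGrad_colM`, an2's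
`KernelWardResponse.coDressKBmAt_KInvStep_inr_inr_off`; G-an2-4 formalisation swarm, leaf prover `b2b-balaban-gan24-formalise-leaf-04`, gen 68).  HONEST FRAMING (cell contract, verbatim):
«discharging `BetaPertH` makes Bałaban's UV stability UNCONDITIONAL — a real constructive-QFT result; it is NOT the continuum limit and NOT the Clay problem.»  HONEST DEPENDENCY (verbatim):
«continuum YM on T⁴ ⇐ BetaPertH ∧ nine spine estimates (0/9 proved); BetaPertH ⇐ (D1) ∧ (D4) ∧ CAP+tail; G-an2-4 gates asym, D1 and NE2/3/4.»

WHAT ([folklore]; generic `d`, in-block root `ρ = toSite r`, `[NeZero Lc]`, every `j`, all units `s_f s_m`; 0 `def`, 0 cited facts, 0 `def … : Prop`, 0 sorry): `sawtooth_step`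
(`((n+1) % Lc) − (n % Lc) = 1 − Lc·[n % Lc = Lc−1]` over `ℝ`, as a `have`-grade letter), `tsum_sawtoothGrad_mul_dressed_mm_eq_zero` (the pure-gauge datum), **`tsum_face_mul_dressed_mm_eq_zero`**
(the headline; the `C_j(𝟙f_β) = 0` socket of `LegWeightedDressedRow.tsum_legWeight_mulRow_comp` in the (D)-tower).  Asserts NO value of Bałaban's tables; discharges NOTHING of (C)sym ∕ (Q-D) ∕
(Q-D-rate) ∕ «T2Shape» ∕ «T2Drift» ∕ (hW, hWall); NEVER «G-an2-4 closed» as (CONV-C); NOT D1, NOT `BetaPertH`, NOT continuum, NOT Clay.  2026-08-23; no existing file touched.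
-/

noncomputable section

open Finset
open scoped BigOperators
open Literature.MathematicalPhysics.QuantumFieldTheory
open Literature.MathematicalPhysics.QuantumFieldTheory.Balaban1983to89
open Literature.MathematicalPhysics.QuantumFieldTheory.Balaban1983to89.Beta
open ExpKernelCalculus (Site MKer)
open AffineAveraging (box toSite)
open B6BondElimination (unitVec unitVec_apply)
open Literature.Probability.LatticeModels (Torus.proj)
open OneStepResolventKernel (Fib eq_zsmul_quo_of_proj)
open LatticeForm (quo)
open OneStepKernelFamily (KInvStep)
open SecondOrderResponse (colM)
open Summit.QuantumFields.BalabanUV.Beta.AxialDressingRooted (coDressKBmAt decays_coDressKBmAt_KInvStep)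
open Summit.QuantumFields.BalabanUV.Beta.GAN24.ResolventLegCharges (summable_exp_coarse')
open Summit.QuantumFields.BalabanUV.Beta.HessKerDressedUnits (unitK unitK_apply legScale_inr)
open Summit.QuantumFields.BalabanUV.Beta.GAN24.VHWordsZeroBorder (hasSum_dressedStep_mm_col)
open Summit.QuantumFields.BalabanUV.Beta.GAN24.CoarseGaugeSourceResponse (sum_tsum_coarseGrad_colM)
open Summit.QuantumFields.BalabanUV.Beta.KernelWardResponse (coDressKBmAt_KInvStep_inr_inr_off)

namespace Summit.QuantumFields.BalabanUV.Beta.GAN24.FaceDatumMultiplierResponse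

variable {d : ℕ} {Lc : ℕ} [NeZero Lc] {r : Fin (d + 1) → ℕ}

omit [NeZero Lc] in
/-- [folklore] **THE SAWTOOTH STEP**: `((n+1) % Lc) − (n % Lc) = 1 − Lc·[n % Lc = Lc−1]` (`1 ≤ Lc`). -/
theorem sawtooth_step (hLc : 1 ≤ Lc) (n : ℤ) :
    ((((n + 1) % (Lc : ℤ) : ℤ) : ℝ)) - (((n % (Lc : ℤ) : ℤ) : ℝ)) = 1 - (Lc : ℝ) * (if n % (Lc : ℤ) = (Lc : ℤ) - 1 then (1 : ℝ) else 0) := by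
  have hL : (0 : ℤ) < Lc := by exact_mod_cast hLc
  have h0 := Int.emod_nonneg n hL.ne'
  have h2 := Int.emod_lt_of_pos n hL
  have hn : n + 1 = (n % (Lc : ℤ) + 1) + (Lc : ℤ) * (n / (Lc : ℤ)) := by
    have := Int.emod_add_mul_ediv n (Lc : ℤ)
    linarith
  have hstep : (n + 1) % (Lc : ℤ) = (n % (Lc : ℤ) + 1) % (Lc : ℤ) := by
    rw [hn, Int.add_mul_emod_self_left]
  by_cases h : n % (Lc : ℤ) = (Lc : ℤ) - 1
  · rw [if_pos h, hstep, h, sub_add_cancel, Int.emod_self]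
    push_cast
    ring
  · rw [if_neg h, mul_zero, sub_zero, hstep, Int.emod_eq_of_lt (by omega) (by omega)]
    push_cast
    ring

/-- [folklore] **THE MULTIPLIER RESPONSE TO THE SAWTOOTH'S COARSE GRADIENT VANISHES**: `Σ'_w (λ_β(w + e_β) − λ_β(w))·X̃♮_j q (Lc•w) (inr m) (inr β) = 0`, `λ_β(w) = w_β % Lc`
(p2's `sum_tsum_coarseGrad_colM` at a coarse first leg — the other directions of the gradient vanish since `λ_β` depends on `w_β` only; off the coarse lattice the mm block is zero). -/
theorem tsum_sawtoothGrad_mul_dressed_mm_eq_zero (sf sm : ℝ) (j : ℕ) (β m : Fin (d + 1)) (q : Site (d + 1)) :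
    ∑' w : Site (d + 1), ((((((w + unitVec β) β % (Lc : ℤ) : ℤ) : ℝ)) - (((w β % (Lc : ℤ) : ℤ) : ℝ))) *
        unitK sf sm (coDressKBmAt (toSite r) Lc (KInvStep (d := d) Lc j)) q ((Lc : ℤ) • w) (Sum.inr m) (Sum.inr β)) = 0 := by
  by_cases hq : Torus.proj Lc q = 0
  · -- coarse first leg `q = Lc • v`
    have hqv := eq_zsmul_quo_of_proj (N := Lc) hq
    set φ : Site (d + 1) → ℝ := fun w => (((w β % (Lc : ℤ) : ℤ) : ℝ)) with hφ
    have hL : (0 : ℤ) < Lc := by exact_mod_cast Nat.pos_of_ne_zero (NeZero.ne Lc)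
    have hφb : ∀ w, |φ w| ≤ (Lc : ℝ) := by
      intro w
      simp only [hφ]
      rw [abs_of_nonneg (by exact_mod_cast Int.emod_nonneg _ hL.ne')]
      exact_mod_cast (Int.emod_lt_of_pos (w β) hL).le
    have h := sum_tsum_coarseGrad_colM (Lc := Lc) (toSite r) j φ hφb m (quo Lc q)
    -- only `μ = β` survives
    rw [Finset.sum_eq_single β (fun μ _ hμ => ?_) (fun hb => absurd (Finset.mem_univ β) hb)] at h
    · have e : ∀ w : Site (d + 1), ((((((w + unitVec β) β % (Lc : ℤ) : ℤ) : ℝ)) - (((w β % (Lc : ℤ) : ℤ) : ℝ))) *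
          unitK sf sm (coDressKBmAt (toSite r) Lc (KInvStep (d := d) Lc j)) q ((Lc : ℤ) • w) (Sum.inr m) (Sum.inr β)) =
          (sm * sm) * ((φ (w + unitVec β) - φ w) * colM (coDressKBmAt (toSite r) Lc (KInvStep (d := d) Lc j)) Lc β w m (quo Lc q)) := by
        intro w
        simp only [hφ, unitK_apply, legScale_inr, colM]
        rw [← hqv]
        ring
      rw [tsum_congr e, tsum_mul_left, h, mul_zero]
    · have e0 : ∀ w : Site (d + 1), φ (w + unitVec μ) - φ w = 0 := by
        intro w
        simp only [hφ, Pi.add_apply, unitVec_apply, if_neg (Ne.symm hμ), add_zero, sub_self]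
      simp only [e0, zero_mul, tsum_zero]
  · -- off the coarse lattice the mm block vanishes
    have e : ∀ w : Site (d + 1), unitK sf sm (coDressKBmAt (toSite r) Lc (KInvStep (d := d) Lc j)) q ((Lc : ℤ) • w) (Sum.inr m) (Sum.inr β) = 0 := by
      intro w
      rw [unitK_apply, coDressKBmAt_KInvStep_inr_inr_off (toSite r) j q hq _ m β, mul_zero, zero_mul]
    simp only [e, mul_zero, tsum_zero]

/-- [folklore] **THE MULTIPLIER RESPONSE OF THE DRESSED STEP KERNEL TO THE EXIT-FACE DATUM VANISHES** (in-block root, every `j`, all units, every first leg `q`, every `β m`):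
`Σ'_w 𝟙f(w_β)·X̃♮_j q (Lc•w) (inr m) (inr β) = 0` — `Lc·𝟙f = 1 − d(sawtooth)`, the constant datum by 26's `hasSum_dressedStep_mm_col`, the gradient by the previous theorem. -/
theorem tsum_face_mul_dressed_mm_eq_zero (hLc : 1 ≤ Lc) (hr : r ∈ box (d + 1) Lc) (sf sm : ℝ) (j : ℕ) (β m : Fin (d + 1)) (q : Site (d + 1)) :
    ∑' w : Site (d + 1), (if w β % (Lc : ℤ) = (Lc : ℤ) - 1 then (1 : ℝ) else 0) *
        unitK sf sm (coDressKBmAt (toSite r) Lc (KInvStep (d := d) Lc j)) q ((Lc : ℤ) • w) (Sum.inr m) (Sum.inr β) = 0 := by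
  have hL0 : (Lc : ℝ) ≠ 0 := by exact_mod_cast (show Lc ≠ 0 by omega)
  have h1 := (hasSum_dressedStep_mm_col (d := d) hLc hr sf sm j q β m)
  have h2 := tsum_sawtoothGrad_mul_dressed_mm_eq_zero (d := d) (Lc := Lc) (r := r) sf sm j β m q
  -- `𝟙f(w_β) = Lc⁻¹·(1 − (λ(w+e_β) − λ(w)))`
  have e : ∀ w : Site (d + 1), (if w β % (Lc : ℤ) = (Lc : ℤ) - 1 then (1 : ℝ) else 0) *
      unitK sf sm (coDressKBmAt (toSite r) Lc (KInvStep (d := d) Lc j)) q ((Lc : ℤ) • w) (Sum.inr m) (Sum.inr β) =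
      (Lc : ℝ)⁻¹ * unitK sf sm (coDressKBmAt (toSite r) Lc (KInvStep (d := d) Lc j)) q ((Lc : ℤ) • w) (Sum.inr m) (Sum.inr β)
        - (Lc : ℝ)⁻¹ * ((((((w + unitVec β) β % (Lc : ℤ) : ℤ) : ℝ)) - (((w β % (Lc : ℤ) : ℤ) : ℝ))) *
          unitK sf sm (coDressKBmAt (toSite r) Lc (KInvStep (d := d) Lc j)) q ((Lc : ℤ) • w) (Sum.inr m) (Sum.inr β)) := by
    intro w
    have hs := sawtooth_step hLc (w β)
    have ew : (w + unitVec β) β = w β + 1 := by simp only [Pi.add_apply, unitVec_apply, if_true]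
    rw [ew, hs]
    field_simp
    ring
  -- summability of the two families
  obtain ⟨δ, C, hδ, hC, hK⟩ := decays_coDressKBmAt_KInvStep (d := d) hr j
  have hsK : Summable fun w : Site (d + 1) => |unitK sf sm (coDressKBmAt (toSite r) Lc (KInvStep (d := d) Lc j)) q ((Lc : ℤ) • w) (Sum.inr m) (Sum.inr β)| := by
    refine Summable.of_nonneg_of_le (fun _ => abs_nonneg _) (fun w => ?_) ((summable_exp_coarse' (d := d) hLc hδ q).mul_left (|sm| * C * |sm|))
    rw [unitK_apply, legScale_inr, legScale_inr, abs_mul, abs_mul]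
    have h := hK q ((Lc : ℤ) • w) (Sum.inr m) (Sum.inr β)
    calc |sm| * |coDressKBmAt (toSite r) Lc (KInvStep (d := d) Lc j) q ((Lc : ℤ) • w) (Sum.inr m) (Sum.inr β)| * |sm|
        ≤ |sm| * (C * Real.exp (-δ * B12Sec2to5.l1 (q - (Lc : ℤ) • w))) * |sm| :=
          mul_le_mul_of_nonneg_right (mul_le_mul_of_nonneg_left h (abs_nonneg _)) (abs_nonneg _)
      _ = |sm| * C * |sm| * Real.exp (-δ * B12Sec2to5.l1 (q - (Lc : ℤ) • w)) := by ring
  have hgB : ∀ w : Site (d + 1), |((((w + unitVec β) β % (Lc : ℤ) : ℤ) : ℝ)) - (((w β % (Lc : ℤ) : ℤ) : ℝ))| ≤ 1 + (Lc : ℝ) := by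
    intro w
    have ew : (w + unitVec β) β = w β + 1 := by simp only [Pi.add_apply, unitVec_apply, if_true]
    rw [ew, sawtooth_step hLc (w β)]
    split_ifs
    · rw [mul_one, abs_le]; constructor <;> nlinarith [(show (1 : ℝ) ≤ Lc by exact_mod_cast hLc)]
    · rw [mul_zero, sub_zero, abs_one]; linarith [(show (0 : ℝ) ≤ Lc by positivity)]
  have hs2 : Summable fun w : Site (d + 1) => ((((((w + unitVec β) β % (Lc : ℤ) : ℤ) : ℝ)) - (((w β % (Lc : ℤ) : ℤ) : ℝ))) *
      unitK sf sm (coDressKBmAt (toSite r) Lc (KInvStep (d := d) Lc j)) q ((Lc : ℤ) • w) (Sum.inr m) (Sum.inr β)) := by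
    refine Summable.of_norm_bounded (hsK.mul_left (1 + (Lc : ℝ))) (fun w => ?_)
    rw [Real.norm_eq_abs, abs_mul]
    exact mul_le_mul_of_nonneg_right (hgB w) (abs_nonneg _)
  rw [tsum_congr e, (h1.summable.mul_left ((Lc : ℝ)⁻¹)).tsum_sub (hs2.mul_left ((Lc : ℝ)⁻¹)), tsum_mul_left, tsum_mul_left, h1.tsum_eq, h2, mul_zero, sub_zero]

end Summit.QuantumFields.BalabanUV.Beta.GAN24.FaceDatumMultiplierResponse

end
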